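import Literature.AlgebraicGeometry.HodgeTheory.SaitoGrFDeRham
import Literature.AlgebraicGeometry.Motives.SubHodgeStructureConj
import Literature.AlgebraicGeometry.HodgeTheory.ClassesSupportedOn
import Literature.AlgebraicGeometry.HodgeTheory.HodgeFiltration
import Literature.AlgebraicGeometry.Motives.CurveNet
import HarnessLib

/-!
# Saito's `Gr^F DR(IC(R¹π_*ℚ))` package of a curve net, anchored to the cohomology of the total space

Family `hodge`, layer `Literature/AlgebraicGeometry/HodgeTheory`. Second half of the definition request
`SaitoGrFDeRham` (route `HodgeConjecture/CurveNetMordellWeil`, crux `VerticalSupportMiddle`): for a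
curve net `N : Motives.CurveNet m X` over `ℂ` (total space `X̃ = N.total` smooth projective of
dimension `m + 1`, net map `π = N.proj : X̃ → ℙᵐ`, discriminant `Δ`, smooth base `U = ℙᵐ ∖ Δ`), the
abstract package `SaitoGrFDeRhamData m 1` of the polarizable pure Hodge module
`M = j_{!*}(R¹π_*ℚ|_U)[m]` of weight `m + 1` on `ℙᵐ` [Popa2017, §4 Thm. 5] is PINNED to the real
carriers of the tree by the comparison maps `ρ_F` below, and its existence is stated as the named
fact `curveNetSaitoData_nonempty` (the CONSTRUCTION statement the planner asked to keep separate).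

## The anchor `ρ_F` (decomposition theorem + Deligne's weights; why it is canonical)

Fix a form `F` of degree `e ≥ 1` with `Δ ⊆ T := V(F)` (an ADMISSIBLE form, `CurveNet.IsAdmissibleForm`),
so that `U_T = ℙᵐ ∖ T ⊆ U` is affine and `π_T : X̃_T = π⁻¹(U_T) → U_T` is smooth projective with
connected curves as fibres. Assume `m ≥ 2`.
1. Leray for `π_T` degenerates (Deligne 1968) and `Rπ_{T*}ℚ ≅ ℚ ⊕ R¹[-1] ⊕ ℚ(-1)[-2]`; since `U_T` is
   affine of dimension `m`, `H^{m+1}(U_T; ℚ) = 0` (Artin), so there is a canonical exact sequence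
   `0 → Hᵐ(U_T, R¹) → H^{m+1}(X̃_T; ℚ) —π_{T*}→ H^{m-1}(U_T; ℚ)(-1) → 0` of mixed Hodge structures.
2. For `c ∈ H^{m+1}(X̃; ℚ)`, `π_{T*}(c|_{X̃_T}) = (π_*c)|_{U_T}` with `π_*c ∈ H^{m-1}(ℙᵐ) = ℚ·h^{(m-1)/2}`
   (`m` odd; `0` for `m` even) and `h|_{U_T} = e⁻¹·cl(T)|_{U_T} = 0`; for `m ≥ 2` the exponent is
   `≥ 1`, so the restriction `r_T : H^{m+1}(X̃) → H^{m+1}(X̃_T)` lands in `Hᵐ(U_T, R¹)`. (For `m = 1`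
   the fibre degree survives: excluded.)
3. `im r_T = W_{m+1} H^{m+1}(X̃_T)` [DeligneHodgeII1971, Cor. 3.2.17], and by the decomposition
   theorem for `π` [BBD1982, Thm. 6.2.5; DecataldoMigliorini2009BAMS, §1.5–1.6] restricted to `U_T`
   (`ᵖH⁰(Rπ_*ℚ[m+1]) = IC(R¹|_U) ⊕ (summands supported on Δ ⊆ T)`, the `ᵖH^{±1}`-components of `r_T`
   vanish by 1–2), `im r_T = im(IHᵐ(ℙᵐ, M) → IHᵐ(U_T, M) = Hᵐ(U_T, R¹))` as the SAME subobject of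
   `H^{m+1}(X̃_T)`; the kernel of `IHᵐ(ℙᵐ, M) → IHᵐ(ℙᵐ ∖ T, M)` is `IHᵐ_T = ihSupported T`.
Hence a canonical isomorphism of Hodge structures `H^{m+1}(X̃)/H^{m+1}_{π⁻¹T}(X̃) ≅ IHᵐ/IHᵐ_T`, i.e. a
surjection `ρ_T : H^{m+1}(X̃(ℂ); ℂ) ↠ (IHᵐ ⊗ ℂ)/(IHᵐ_T ⊗ ℂ)` with kernel EXACTLY the classes supported
on `π⁻¹(T)` (the tree's `classesSupportedOn N.total (π⁻¹T) (m+1)`, a real carrier), defined over `ℚ`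
(`IsRationalClass ↦ ofRat`), filtered (`IsInHodgeFiltration r ↦ F^r`, Hodge models of `X̃`), and
compatible with enlarging `T` — the fields of `CurveNetSaitoData`. All Hodge structures involved agree
with Deligne's [Saito1990, Thm. 0.1–0.2].

## How the route uses it (the typed engine)

For a rational `(q,q)`-class `c ∈ H^{2q}(X̃)`, `m = 2q - 1`: `ρ_F c = [y]` with `y ∈ F^q` rational; its
`Gr_F^q`-component `s = comparison⁻¹ [y] ∈ ℍ⁰(ℙᵐ, K_{-q})`. ENGINE (to be filed by the planner):
`s` is `IsHodgeSupportedSection … (V(G))` for some admissible `G` (for nets of large degree). Then, with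
`T' = V(F·G)`, `ρ_{FG} c` is a rational class of the pure weight-`2q` Hodge structure `IHᵐ/IHᵐ_{T'}`
lying in `F^q` with zero `Gr_F^q`-component, hence `0`; so `c ∈ ker ρ_{FG} = H^{2q}_{π⁻¹T'}(X̃)`:
base-coniveau `≥ 1`, i.e. `VerticalSupportMiddle`. (Coherent support `G^N·s = 0` alone does NOT
suffice: module docstring of `SaitoGrFDeRham`.)

## What is defined

* `CurveNet.IsAdmissibleForm N F` — `F` homogeneous of some degree `e ≥ 1` with `Δ ⊆ V(F)`.
* `CurveNetSaitoData N extends SaitoGrFDeRhamData m 1` — adds `rho F` (`ρ_F`) and its five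
  properties `surjective_rho`, `ker_rho`, `rho_mul`, `rho_rational`, `rho_hodgeFiltration`.
* the named fact `curveNetSaitoData_nonempty` (`2 ≤ m`): Saito's theory provides an instance.
* API: `rho_eq_zero_iff` (a class dies under `ρ_F` iff it is supported on `π⁻¹V(F)`),
  `restrictCompl_eq_zero_of_rho_mul_eq_zero` (the shape of the conclusion of
  `VerticalSupportMiddle`), THE BRIDGE `restrictCompl_eq_zero_of_isHodgeSupportedSection` (Hodge
  support of the `Gr_F^q`-component of a rational class ⇒ the class is supported on the preimage of
  a hypersurface; proved from the fields + `Motives/SubHodgeStructureConj`), `rho_zero_apply`,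
  `CurveNet.isAdmissibleForm_mul`,
  `isClosed_projHypersurface`, `projHypersurface_ne_univ`, `isClosed_preimage_projHypersurface`,
  `exists_form_of_isClosed_of_ne_univ` (proper closed sets lie on hypersurfaces) and
  `CurveNet.exists_isAdmissibleForm_ne_zero` (`Δ ≠ ℙᵐ ⇒` a nonzero admissible form exists).

## Faithfulness: what `curveNetSaitoData_nonempty` pins, and what it cannot

PINNED to real carriers: by `ker_rho`/`surjective_rho`/`rho_rational`/`rho_hodgeFiltration`, for every
admissible `F` simultaneously, `IH 0 / ihSupported V(F) ≅ H^{m+1}(X̃)/H^{m+1}_{π⁻¹V(F)}(X̃)` with its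
rational structure and Hodge filtration (Hodge models of `X̃`); through `comparison`, the twist-`0`
pieces `ℍ⁰(ℙᵐ, K_k) = Gr_F^{-k} IHᵐ_ℂ` and the Hodge-support predicate. NOT PINNED (no carrier exists
in the tree or Mathlib): the pieces with `t ≠ 0`, the `S`-action, `IH j` for `j ≠ 0` beyond their
abstract properties — so Kodaira–Saito vanishing and "functoriality in twists" describe the intended
instance but cannot be exploited against the real objects inside Lean; an argument whose content lives
in the twists (Castelnuovo–Mumford regularity in the net degree, Beilinson monads, Bott vanishing)
needs further posited structure on the same `K` (the terms of `K_k` as graded `S`-modules) or a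
computation outside Lean. The ENGINE itself is a twist-`0` statement (`IsHodgeSupportedSection`) and is
therefore meaningful as typed.

## References

* [Saito1990] Thm. 0.1–0.2 (mixed Hodge modules; compatibility with Deligne), §2.g, §4.5.
  [SaitoMHP1988] Thm. 5.3.1. [Popa2017] §4 Thm. 5–7. [BBD1982] Thm. 6.2.5, §4.1.
  [DecataldoMigliorini2009BAMS] §1.5–1.6. [DeligneHodgeII1971] Cor. 3.2.17 (`W_n Hⁿ(X°) = im Hⁿ(X̄)`).
  [Arapura2022] §1 (fibred varieties, `U` = complement of the discriminant).
-/

noncomputable section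

open scoped TensorProduct
open CategoryTheory AlgebraicGeometry

namespace Literature.AlgebraicGeometry.HodgeTheory

section HodgeTheory

variable {m : ℕ} {X : Motives.SchemeOver ℂ}

/-! ### Admissible forms (dot-notation extensions of `Motives.CurveNet`, declared by absolute name) -/

/-- A polynomial `F ∈ ℂ[x₀, …, xₘ]` is an **admissible form for the curve net `N`**: it is
homogeneous of some degree `e ≥ 1` and its hypersurface `V(F)` contains the discriminant `Δ` of
`N`, so that `ℙᵐ ∖ V(F)` is an affine open subset of the smooth base over which `π` is a smooth
projective family of curves (Arapura 2022, §1: shrink `U` to an affine complement of a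
hypersurface). `F = 0` is allowed (`V(0) = ℙᵐ`, everything degenerates consistently).
[cite: Arapura2022, §1] -/
def _root_.Literature.AlgebraicGeometry.Motives.CurveNet.IsAdmissibleForm (N : Motives.CurveNet m X)
    (F : MvPolynomial (Fin (m + 1)) ℂ) : Prop :=
  (∃ e : ℕ, 1 ≤ e ∧ F.IsHomogeneous e) ∧ N.discriminant ⊆ projHypersurface m F

/-- Admissible forms are stable under multiplication by forms (`V(F) ⊆ V(F·G)`). [cite: Arapura2022, §1] -/
theorem _root_.Literature.AlgebraicGeometry.Motives.CurveNet.isAdmissibleForm_mul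
    (N : Motives.CurveNet m X) {F G : MvPolynomial (Fin (m + 1)) ℂ} (hF : N.IsAdmissibleForm F)
    {e' : ℕ} (hG : G.IsHomogeneous e') : N.IsAdmissibleForm (F * G) := by
  obtain ⟨⟨e, he, hFe⟩, hΔ⟩ := hF
  exact ⟨⟨e + e', by omega, hFe.mul hG⟩, hΔ.trans (projHypersurface_subset_mul m F G)⟩

/-- The zero polynomial is admissible (degenerate case `V(0) = ℙᵐ`). [cite: Arapura2022, §1] -/
theorem _root_.Literature.AlgebraicGeometry.Motives.CurveNet.isAdmissibleForm_zero
    (N : Motives.CurveNet m X) : N.IsAdmissibleForm 0 :=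
  ⟨⟨1, le_rfl, MvPolynomial.isHomogeneous_zero _ _ _⟩, by
    rw [projHypersurface_zero]; exact Set.subset_univ _⟩

/-! ### Hypersurfaces: closedness and properness (for the shape of `VerticalSupportMiddle`) -/

/-- Hypersurfaces `V(F) ⊆ ℙᵐ` are Zariski closed. [folklore] -/
theorem isClosed_projHypersurface (m : ℕ) (F : MvPolynomial (Fin (m + 1)) ℂ) :
    IsClosed (projHypersurface m F) :=
  letI := MvPolynomial.gradedAlgebra (σ := Fin (m + 1)) (R := ℂ)
  ProjectiveSpectrum.isClosed_zeroLocus _ _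

/-- The preimage `π⁻¹V(F) ⊆ X̃` of a hypersurface under the net map is Zariski closed. [folklore] -/
theorem isClosed_preimage_projHypersurface (N : Motives.CurveNet m X)
    (F : MvPolynomial (Fin (m + 1)) ℂ) : IsClosed (N.proj.left.base ⁻¹' projHypersurface m F) :=
  (isClosed_projHypersurface m F).preimage N.proj.left.continuous

/-- `V(F) ≠ ℙᵐ` for `F ≠ 0`: the generic point of `ℙᵐ` (the zero ideal, a relevant homogeneous
prime) does not lie on any hypersurface. [folklore] -/
theorem projHypersurface_ne_univ (m : ℕ) {F : MvPolynomial (Fin (m + 1)) ℂ} (hF : F ≠ 0) :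
    projHypersurface m F ≠ Set.univ := by
  letI := MvPolynomial.gradedAlgebra (σ := Fin (m + 1)) (R := ℂ)
  intro h
  have hirr : ¬ HomogeneousIdeal.irrelevant (MvPolynomial.homogeneousSubmodule (Fin (m + 1)) ℂ) ≤ ⊥ := by
    intro hle
    have hX : (MvPolynomial.X 0 : MvPolynomial (Fin (m + 1)) ℂ) ∈
        HomogeneousIdeal.irrelevant (MvPolynomial.homogeneousSubmodule (Fin (m + 1)) ℂ) := by
      rw [HomogeneousIdeal.mem_irrelevant_iff, GradedRing.proj_apply]
      exact DirectSum.decompose_of_mem_ne _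
        ((MvPolynomial.mem_homogeneousSubmodule 1 _).mpr (MvPolynomial.isHomogeneous_X ℂ 0)) one_ne_zero
    have h0 : (MvPolynomial.X 0 : MvPolynomial (Fin (m + 1)) ℂ) ∈ (⊥ : HomogeneousIdeal _) := hle hX
    rw [← HomogeneousIdeal.mem_iff, HomogeneousIdeal.toIdeal_bot, Ideal.mem_bot] at h0
    exact MvPolynomial.X_ne_zero 0 h0
  let η : ProjectiveSpectrum (MvPolynomial.homogeneousSubmodule (Fin (m + 1)) ℂ) :=
    { asHomogeneousIdeal := ⊥
      isPrime := by rw [HomogeneousIdeal.toIdeal_bot]; exact Ideal.isPrime_bot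
      not_irrelevant_le := hirr }
  have hη : (η : (Motives.projectiveSpace m ℂ).left) ∈ projHypersurface m F := by
    rw [h]; trivial
  have hF0 : F ∈ (⊥ : HomogeneousIdeal (MvPolynomial.homogeneousSubmodule (Fin (m + 1)) ℂ)) := by
    have : ({F} : Set (MvPolynomial (Fin (m + 1)) ℂ)) ⊆ η.asHomogeneousIdeal := hη
    exact Set.singleton_subset_iff.mp this
  rw [← HomogeneousIdeal.mem_iff, HomogeneousIdeal.toIdeal_bot, Ideal.mem_bot] at hF0
  exact hF hF0

/-- **Every proper Zariski-closed subset of `ℙᵐ` lies on a hypersurface**: for `Z ⊆ ℙᵐ` closed and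
`≠ ℙᵐ` there is a nonzero form `F` of degree `≥ 1` with `Z ⊆ V(F)` (closed sets are zero loci of
sets of polynomials; a polynomial `g` of the locus not vanishing at some point has a homogeneous
component `c ∉ 𝔭_x`, and `Z ⊆ V(c)`; if `c` were constant `Z` would be empty and any `V(x₀)` works).
Used to produce admissible forms from `Δ ≠ ℙᵐ`. [folklore] -/
theorem exists_form_of_isClosed_of_ne_univ (m : ℕ) {Z : Set (Motives.projectiveSpace m ℂ).left}
    (hZ : IsClosed Z) (hne : Z ≠ Set.univ) :
    ∃ (F : MvPolynomial (Fin (m + 1)) ℂ) (e : ℕ), 1 ≤ e ∧ F.IsHomogeneous e ∧ F ≠ 0 ∧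
      Z ⊆ projHypersurface m F := by
  letI := MvPolynomial.gradedAlgebra (σ := Fin (m + 1)) (R := ℂ)
  -- `Z` is the zero locus of a set `s` of polynomials
  obtain ⟨s, hs⟩ := (ProjectiveSpectrum.isClosed_iff_zeroLocus (𝒜 := MvPolynomial.homogeneousSubmodule (Fin (m + 1)) ℂ) Z).mp hZ
  -- a point `x ∉ Z` and a `g ∈ s` not vanishing at `x`
  obtain ⟨x, hx⟩ := Set.ne_univ_iff_exists_notMem _ |>.mp hne
  have hx' : ¬ (s ⊆ (x : ProjectiveSpectrum (MvPolynomial.homogeneousSubmodule (Fin (m + 1)) ℂ)).asHomogeneousIdeal) := by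
    intro hsub; exact hx (hs ▸ hsub)
  obtain ⟨g, hgs, hgx⟩ := Set.not_subset.mp hx'
  -- some homogeneous component `c` of `g` does not vanish at `x`
  have hcomp : ∃ i, (DirectSum.decompose (MvPolynomial.homogeneousSubmodule (Fin (m + 1)) ℂ) g i : MvPolynomial (Fin (m + 1)) ℂ) ∉
      (x : ProjectiveSpectrum (MvPolynomial.homogeneousSubmodule (Fin (m + 1)) ℂ)).asHomogeneousIdeal := by
    by_contra hall
    push Not at hall
    apply hgx
    rw [SetLike.mem_coe, ← HomogeneousIdeal.mem_iff,
      (x : ProjectiveSpectrum (MvPolynomial.homogeneousSubmodule (Fin (m + 1)) ℂ)).asHomogeneousIdeal.isHomogeneous.mem_iff]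
    intro i
    exact (HomogeneousIdeal.mem_iff).mpr (hall i)
  obtain ⟨i, hi⟩ := hcomp
  set c : MvPolynomial (Fin (m + 1)) ℂ :=
    ↑(DirectSum.decompose (MvPolynomial.homogeneousSubmodule (Fin (m + 1)) ℂ) g i) with hc
  have hc0 : c ≠ 0 := by
    intro h0; apply hi; rw [h0]; exact Submodule.zero_mem _
  have hchom : c.IsHomogeneous i :=
    (MvPolynomial.mem_homogeneousSubmodule i c).mp (DirectSum.decompose (MvPolynomial.homogeneousSubmodule (Fin (m + 1)) ℂ) g i).2
  -- every point of `Z` kills `g`, hence `c`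
  have hcZ : ∀ z : ProjectiveSpectrum (MvPolynomial.homogeneousSubmodule (Fin (m + 1)) ℂ), (z : (Motives.projectiveSpace m ℂ).left) ∈ Z →
      c ∈ z.asHomogeneousIdeal := by
    intro z hz
    have hz' : (z : (Motives.projectiveSpace m ℂ).left) ∈
        (ProjectiveSpectrum.zeroLocus (MvPolynomial.homogeneousSubmodule (Fin (m + 1)) ℂ) s : Set (ProjectiveSpectrum (MvPolynomial.homogeneousSubmodule (Fin (m + 1)) ℂ))) := hs ▸ hz
    have hg : g ∈ z.asHomogeneousIdeal := hz' hgs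
    rw [← HomogeneousIdeal.mem_iff, z.asHomogeneousIdeal.isHomogeneous.mem_iff] at hg
    exact (HomogeneousIdeal.mem_iff).mp (hg i)
  rcases Nat.eq_zero_or_pos i with rfl | hipos
  · -- degree-`0` component: a nonzero constant kills every point of `Z`, so `Z = ∅`
    refine ⟨MvPolynomial.X 0, 1, le_rfl, MvPolynomial.isHomogeneous_X ℂ 0, MvPolynomial.X_ne_zero 0, ?_⟩
    intro z hz
    exfalso
    have hcz := hcZ z hz
    have hcC : c = MvPolynomial.C (c.coeff 0) :=
      MvPolynomial.totalDegree_eq_zero_iff_eq_C.mp (hchom.totalDegree hc0)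
    have hr : c.coeff 0 ≠ 0 := by
      intro h0
      apply hc0
      rw [hcC, h0, map_zero]
    have hunit : IsUnit c := by
      rw [hcC]
      exact (isUnit_iff_ne_zero.mpr hr).map MvPolynomial.C
    exact z.isPrime.ne_top (Ideal.eq_top_of_isUnit_mem _ ((HomogeneousIdeal.mem_iff).mpr hcz) hunit)
  · exact ⟨c, i, hipos, hchom, hc0, fun z hz => by
      have := hcZ z hz
      change ({c} : Set (MvPolynomial (Fin (m + 1)) ℂ)) ⊆ _
      exact Set.singleton_subset_iff.mpr this⟩

/-- A curve net whose discriminant is not all of `ℙᵐ` (always the case in characteristic `0`, by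
generic smoothness — not a field of `CurveNet`) admits a NONZERO admissible form. [cite: Arapura2022, §1] -/
theorem _root_.Literature.AlgebraicGeometry.Motives.CurveNet.exists_isAdmissibleForm_ne_zero
    (N : Motives.CurveNet m X) (hΔ : N.discriminant ≠ Set.univ) :
    ∃ F : MvPolynomial (Fin (m + 1)) ℂ, N.IsAdmissibleForm F ∧ F ≠ 0 := by
  obtain ⟨F, e, he, hFe, hF0, hsub⟩ :=
    exists_form_of_isClosed_of_ne_univ m N.isClosed_discriminant hΔ
  exact ⟨F, ⟨⟨e, he, hFe⟩, hsub⟩, hF0⟩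

/-! ### The anchored package -/

/-- **Saito's `Gr^F` de Rham package of `IC(R¹π_*ℚ)` for a curve net `N` on `ℙᵐ_ℂ`, anchored to the
total space.** Extends the abstract package `SaitoGrFDeRhamData m 1` (hypercohomology of the twists
of `K_k = Gr^F_k DR(ℳ)`, Kodaira–Saito vanishing, the Hodge structures `IHʲ⁺ᵐ = Hʲ(ℙᵐ, M)`,
comparison, supports) of the pure Hodge module `M = j_{!*}(R¹π_*ℚ|_U)` of weight `m + 1` by the
canonical comparison maps (module docstring, steps 1–3): for every polynomial `F`,
`ρ F : H^{m+1}(X̃(ℂ); ℂ) →ₗ (IHᵐ ⊗ ℂ)/(IHᵐ_{V(F)} ⊗ ℂ)`, which for ADMISSIBLE `F` (homogeneous of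
degree `≥ 1`, `Δ ⊆ V(F)`) is surjective with kernel the classes supported on `π⁻¹V(F)`, maps rational
classes to rational classes and `Fʳ` to `Fʳ`, and is compatible with `V(F) ⊆ V(F·G)`. For
non-admissible `F` the value of `ρ F` is unconstrained (junk). Intended for `m ≥ 2` (for `m = 1` the
fibre degree obstructs step 2 and the structure is not inhabited as stated); existence is the
named fact `curveNetSaitoData_nonempty`. [cite: Saito1990, Thm. 0.1–0.2 and §2.g]
[cite: BBD1982, Thm. 6.2.5] [cite: DeligneHodgeII1971, Cor. 3.2.17] [cite: Popa2017, §4 Thm. 5–7] -/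
structure CurveNetSaitoData (N : Motives.CurveNet m X) extends SaitoGrFDeRhamData m 1 where
  /-- The comparison map `ρ_F : H^{m+1}(X̃(ℂ); ℂ) → (IHᵐ ⊗ ℂ)/(IHᵐ_{V(F)} ⊗ ℂ)`. -/
  rho : ∀ F : MvPolynomial (Fin (m + 1)) ℂ,
    ↥(complexBetti N.total (m + 1)) →ₗ[ℂ]
      (ℂ ⊗[ℚ] IH 0) ⧸ ((ihSupported (projHypersurface m F)).toSubmodule.baseChange ℂ)
  /-- `ρ_F` is onto (both sides are `W_{m+1} H^{m+1}(π⁻¹(ℙᵐ ∖ V(F)))`).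
  [cite: DeligneHodgeII1971, Cor. 3.2.17] -/
  surjective_rho : ∀ F, N.IsAdmissibleForm F → Function.Surjective (rho F)
  /-- **The kernel of `ρ_F` is exactly the classes supported on `π⁻¹(V(F))`** (vanishing on the
  complex points over `π⁻¹(ℙᵐ ∖ V(F))`). [cite: BBD1982, Thm. 6.2.5] [cite: DeligneHodgeII1971, Cor. 3.2.17] -/
  ker_rho : ∀ F, N.IsAdmissibleForm F →
    LinearMap.ker (rho F) = classesSupportedOn N.total (N.proj.left.base ⁻¹' projHypersurface m F) (m + 1)
  /-- Compatibility with enlarging the hypersurface by a form `G`: `ρ_{FG} c` is the image of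
  `ρ_F c` (restriction to the smaller affine open `ℙᵐ ∖ V(FG)`). [cite: BBD1982, Thm. 6.2.5] -/
  rho_mul : ∀ F G, N.IsAdmissibleForm F → (∃ e' : ℕ, G.IsHomogeneous e') →
    ∀ (c : ↥(complexBetti N.total (m + 1))) (y : ℂ ⊗[ℚ] IH 0),
      rho F c = Submodule.Quotient.mk y → rho (F * G) c = Submodule.Quotient.mk y
  /-- `ρ_F` is defined over `ℚ`: rational classes go to (images of) rational vectors of `IHᵐ`.
  [cite: Saito1990, Thm. 0.1–0.2] -/
  rho_rational : ∀ F, N.IsAdmissibleForm F → ∀ c : ↥(complexBetti N.total (m + 1)),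
    IsRationalClass c → ∃ v : IH 0, rho F c = Submodule.Quotient.mk (Motives.HodgeStructure.ofRat v)
  /-- `ρ_F` is filtered: a class in `Fʳ H^{m+1}(X̃)` (Hodge models of `X̃`) goes to the image of
  `Fʳ IHᵐ_ℂ` (a morphism of Hodge structures). [cite: Saito1990, Thm. 0.1–0.2] -/
  rho_hodgeFiltration : ∀ F, N.IsAdmissibleForm F → ∀ (r : ℕ) (c : ↥(complexBetti N.total (m + 1))),
    IsInHodgeFiltration (m + 1) N.total (m + 1) r c →
      ∃ y ∈ (hodgeIH 0).F r, rho F c = Submodule.Quotient.mk y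

namespace CurveNetSaitoData

variable {N : Motives.CurveNet m X} (K : CurveNetSaitoData N)

/-- A class dies under `ρ_F` (admissible `F`) iff it is supported on `π⁻¹(V(F))`.
[cite: BBD1982, Thm. 6.2.5] -/
theorem rho_eq_zero_iff {F : MvPolynomial (Fin (m + 1)) ℂ} (hF : N.IsAdmissibleForm F)
    (c : ↥(complexBetti N.total (m + 1))) :
    K.rho F c = 0 ↔
      c ∈ classesSupportedOn N.total (N.proj.left.base ⁻¹' projHypersurface m F) (m + 1) := by
  rw [← K.ker_rho F hF, LinearMap.mem_ker]

/-- Classes supported on `π⁻¹(V(F))` die under `ρ_F`. [cite: BBD1982, Thm. 6.2.5] -/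
theorem rho_eq_zero_of_mem_classesSupportedOn {F : MvPolynomial (Fin (m + 1)) ℂ}
    (hF : N.IsAdmissibleForm F) {c : ↥(complexBetti N.total (m + 1))}
    (hc : c ∈ classesSupportedOn N.total (N.proj.left.base ⁻¹' projHypersurface m F) (m + 1)) :
    K.rho F c = 0 :=
  (K.rho_eq_zero_iff hF c).mpr hc

/-- **Vertical support from the vanishing of `ρ`**: if `ρ_{FG} c = 0` for an admissible `F` and a
form `G`, then `c` restricts to zero on the complex points over `X̃ ∖ π⁻¹V(F·G)`, i.e. `c` is
supported on the preimage of the hypersurface `V(F·G)` — the shape of the conclusion of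
`VerticalSupportMiddle`. [cite: BBD1982, Thm. 6.2.5] -/
theorem restrictCompl_eq_zero_of_rho_mul_eq_zero {F G : MvPolynomial (Fin (m + 1)) ℂ}
    (hF : N.IsAdmissibleForm F) {e' : ℕ} (hG : G.IsHomogeneous e')
    {c : ↥(complexBetti N.total (m + 1))} (hc : K.rho (F * G) c = 0) :
    complexBetti.restrictCompl N.total (N.proj.left.base ⁻¹' projHypersurface m (F * G)) (m + 1) c
      = 0 :=
  mem_classesSupportedOn_iff.mp ((K.rho_eq_zero_iff (N.isAdmissibleForm_mul hF hG) c).mp hc)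

/-- For the degenerate admissible form `F = 0` (`V(0) = ℙᵐ`) every class is in the kernel
(consistency of the junk-free degenerate case: `IHᵐ_{ℙᵐ} = IHᵐ`). [cite: Saito1990, §4.5] -/
theorem rho_zero_apply (c : ↥(complexBetti N.total (m + 1))) : K.rho 0 c = 0 := by
  rw [K.rho_eq_zero_iff N.isAdmissibleForm_zero, projHypersurface_zero, Set.preimage_univ,
    classesSupportedOn_univ]
  exact Submodule.mem_top

/-- **The bridge from Hodge support of the `Gr_F^q`-component to vertical support of the class** (the
composition advertised in the module docstring, proved from the fields and the linear algebra of
`Motives/SubHodgeStructureConj`). Let `m + 1 = 2q`, `F` admissible, `G` a form, `c ∈ H^{2q}(X̃)` a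
rational class with `ρ_F c = [y]`, `y ∈ F^q IHᵐ_ℂ`. If the section `comparison⁻¹ [y] ∈ ℍ⁰(ℙᵐ, K_{-q})`
is Hodge-supported on `V(G)`, then `c` restricts to zero over `X̃ ∖ π⁻¹V(F·G)`. (So the ENGINE
"every section of `ℍ⁰(K_{-q})` is Hodge-supported on some admissible hypersurface" yields
base-coniveau `≥ 1` of rational `(q,q)`-classes, i.e. `VerticalSupportMiddle`.)
[cite: Saito1990, Thm. 0.1 and §4.5] [cite: DeligneHodgeII1971, 1.2.5 and 1.2.10] -/
theorem restrictCompl_eq_zero_of_isHodgeSupportedSection {q : ℕ} (hm : (m : ℤ) + 1 = 2 * q)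
    {F G : MvPolynomial (Fin (m + 1)) ℂ} (hF : N.IsAdmissibleForm F) {e' : ℕ}
    (hG : G.IsHomogeneous e') {c : ↥(complexBetti N.total (m + 1))} (hc : IsRationalClass c)
    {y : ℂ ⊗[ℚ] K.IH 0} (hy : y ∈ (K.hodgeIH 0).F (-(-(q : ℤ))))
    (hρ : K.rho F c = Submodule.Quotient.mk y)
    (hs : K.IsHodgeSupportedSection
      ((K.comparison (-(q : ℤ)) 0).symm ((K.hodgeIH 0).grFMk (-(-(q : ℤ))) ⟨y, hy⟩))
      (projHypersurface m G)) :
    complexBetti.restrictCompl N.total (N.proj.left.base ⁻¹' projHypersurface m (F * G)) (m + 1) c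
      = 0 := by
  apply K.restrictCompl_eq_zero_of_rho_mul_eq_zero hF hG
  -- unpack the Hodge support of the section: `x ∈ F^q ∩ (IH_{V(G)})_ℂ` with the same `Gr_F^q`-class
  obtain ⟨x, hx, hxs⟩ := hs
  have hgr : (K.hodgeIH 0).grFMk (-(-(q : ℤ))) (x - ⟨y, hy⟩) = 0 := by
    rw [map_sub, sub_eq_zero]
    exact (K.comparison (-(q : ℤ)) 0).symm.injective hxs
  have hxy : (x : ℂ ⊗[ℚ] K.IH 0) - y ∈ (K.hodgeIH 0).F (-(-(q : ℤ)) + 1) :=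
    ((K.hodgeIH 0).grFMk_eq_zero_iff _ _).mp hgr
  -- `ρ_{FG} c = [y] = [ofRat v]`
  obtain ⟨v, hv⟩ := K.rho_rational F hF c hc
  have h1 : K.rho (F * G) c = Submodule.Quotient.mk y := K.rho_mul F G hF ⟨e', hG⟩ c y hρ
  have h2 : K.rho (F * G) c = Submodule.Quotient.mk (Motives.HodgeStructure.ofRat v) :=
    K.rho_mul F G hF ⟨e', hG⟩ c _ hv
  set S := K.ihSupported (projHypersurface m (F * G)) with hS
  have hvy : Motives.HodgeStructure.ofRat v - y ∈ S.toSubmodule.baseChange ℂ := by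
    rw [← Submodule.Quotient.eq, ← h2, h1]
  have hxS : (x : ℂ ⊗[ℚ] K.IH 0) ∈ S.toSubmodule.baseChange ℂ := by
    refine Submodule.baseChange_mono ℂ (K.ihSupported_mono ?_) hx
    rw [mul_comm]
    exact projHypersurface_subset_mul m G F
  -- linear algebra of the pure weight-`2q` Hodge structure `IHᵐ` and its sub-Hodge structure `S`
  have hweight : (m : ℤ) + 1 + 0 = 2 * q := by rw [add_zero, hm]
  have hq : -(-(q : ℤ)) + 1 = (q : ℤ) + 1 := by ring
  rw [hq] at hxy
  have hyx : y - x ∈ (K.hodgeIH 0).F ((q : ℤ) + 1) := by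
    have := Submodule.neg_mem _ hxy
    rwa [neg_sub] at this
  have hsub : Motives.HodgeStructure.ofRat v - (y - x) ∈ S.toSubmodule.baseChange ℂ := by
    rw [← sub_add]
    exact Submodule.add_mem _ hvy hxS
  have hvS := S.ofRat_mem_baseChange_of_sub_mem hweight v hyx hsub
  rw [h2, Submodule.Quotient.mk_eq_zero]
  exact hvS

end CurveNetSaitoData

/-- **Named fact (construction): Saito's theory provides the package.** For every curve net `N` on
a smooth projective variety over `ℂ` with base `ℙᵐ`, `m ≥ 2`, the pure Hodge module
`M = j_{!*}(R¹π_*ℚ|_U)` on `ℙᵐ` [Popa2017, §4 Thm. 5 = Saito1990] has graded de Rham complexes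
`Gr^F_k DR(ℳ)` whose twisted hypercohomology, Kodaira–Saito vanishing [Saito1990, §2.g],
intersection-cohomology Hodge structures and comparison [SaitoMHP1988, Thm. 5.3.1], supports, and
the canonical comparison maps `ρ_F` with the cohomology of the total space (decomposition theorem
[BBD1982, Thm. 6.2.5] and [DeligneHodgeII1971, Cor. 3.2.17], module docstring steps 1–3) form a
`CurveNetSaitoData N`. Stated as a named fact: none of the theory exists in Mathlib.
[cite: Saito1990, §2.g and Thm. 0.1] [cite: SaitoMHP1988, Thm. 5.3.1] [cite: BBD1982, Thm. 6.2.5]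
[cite: DeligneHodgeII1971, Cor. 3.2.17] [cite: Popa2017, §4 Thm. 5 and §8 Thm. 23] -/
def curveNetSaitoData_nonempty : Prop :=
  ∀ ⦃m : ℕ⦄ ⦃X : Motives.SchemeOver ℂ⦄ (N : Motives.CurveNet m X), 2 ≤ m →
    Nonempty (CurveNetSaitoData N)

end HodgeTheory

end Literature.AlgebraicGeometry.HodgeTheory

end
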